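import Mathlib
import Literature.Probability.LatticeModels.ScalingLimit3D

/-!
# Sketch — first lemmas for crux ideas on `RotationUpgradeFromTwoPoint` (stmt-CriticalPhenomena-8367)

Ideator 3, round 1. Statements only (sorried); they must elaborate.
-/

noncomputable section

open Literature.Probability.LatticeModels

namespace Summit.CriticalPhenomena.Ising3DConformalLimit.Cruxes.RotationUpgradeFromTwoPoint.Ideator3

local notation "E3" => EuclideanSpace ℝ (Fin 3)

/-- The hyperoctahedral (signed-permutation) isometries `B₃`: linear isometries mapping each
coordinate axis vector `eᵢ` to `± eⱼ`. -/
def IsSignedPermIsometry (R : E3 ≃ₗᵢ[ℝ] E3) : Prop :=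
  ∀ i : Fin 3, ∃ j : Fin 3,
    R (EuclideanSpace.single i 1) = EuclideanSpace.single j 1 ∨
    R (EuclideanSpace.single i 1) = -EuclideanSpace.single j 1

/-- The nine lattice mirror normals `eᵢ`, `eᵢ + eⱼ`, `eᵢ - eⱼ` (as in `GSMRigidity`). -/
def IsLatticeMirrorNormal (n : E3) : Prop :=
  ∃ i j : Fin 3, i ≠ j ∧ (n = EuclideanSpace.single i 1 ∨
    n = EuclideanSpace.single i 1 + EuclideanSpace.single j 1 ∨
    n = EuclideanSpace.single i 1 - EuclideanSpace.single j 1)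

/-! ## Card `two-crystals-generate-so3` — first lemma (pure; provable now)

If a continuous, normalised, translation-invariant family `S` on `ℝ³` with ROUND power-law
two-point function is invariant under `B₃` and under ONE further linear map `g` of exact order 6
and determinant 1 (the transported 6-fold automorphism `L M̃ L⁻¹` of the stacked-triangular
graph), then `S` is `O(3)`-invariant: roundness of `S₂` forces `g` to be an isometry, a proper
rotation of order 6 is not octahedral, the octahedral rotation group is maximal finite and
irreducible, so `⟨B₃, g⟩` is dense in `O(3)`; continuity finishes. -/
theorem rotationInvariant_of_cubic_and_sixfold
    (S : CorrFamily 3) (Δ c : ℝ) (hΔ : 0 < Δ) (hc : 0 < c)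
    (hcont : ∀ n, ContinuousOn (S n) (NonCoincident 3 n))
    (hnorm : ∀ n z, z ∉ NonCoincident 3 n → S n z = 0)
    (htrans : IsTranslationInvariant S)
    (hround : ∀ x : E3, x ≠ 0 → S 2 ![0, x] = c * ‖x‖ ^ (-(2 * Δ)))
    (hB3 : ∀ R : E3 ≃ₗᵢ[ℝ] E3, IsSignedPermIsometry R →
      ∀ n (x : Fin n → E3), S n (fun i => R (x i)) = S n x)
    (g : E3 →ₗ[ℝ] E3) (hg6 : g ^ 6 = 1) (hg2 : g ^ 2 ≠ 1) (hg3 : g ^ 3 ≠ 1)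
    (hdet : LinearMap.det g = 1)
    (hg : ∀ n (x : Fin n → E3), S n (fun i => g (x i)) = S n x) :
    IsRotationInvariant S := by
  sorry

/-- The group-theoretic core, isolated (pure; provable now, needs the pole-counting
classification of finite rotation groups or an ad-hoc argument): a proper rotation of exact
order 6 together with the signed permutations generates a dense subgroup of `O(3)`. -/
theorem dense_closure_signedPerm_sixfold
    (g : E3 ≃ₗᵢ[ℝ] E3) (hg6 : g ^ 6 = 1) (hg2 : g ^ 2 ≠ 1) (hg3 : g ^ 3 ≠ 1)
    (hdet : LinearMap.det (g.toLinearEquiv : E3 →ₗ[ℝ] E3) = 1) :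
    ∀ (R : E3 ≃ₗᵢ[ℝ] E3) (ε : ℝ), 0 < ε →
      ∃ γ ∈ Subgroup.closure ({T : E3 ≃ₗᵢ[ℝ] E3 | IsSignedPermIsometry T} ∪ {g}),
        ∀ x : E3, ‖γ x - R x‖ ≤ ε * ‖x‖ := by
  sorry

/-! ## Card `nine-mirror-crossing-pincer` — the transfer target C⁺ at `n = 4` (first lemma)

Axiomatic four-point rigidity: a translation-invariant, scale-covariant (`1/2 ≤ Δ ≤ 1`),
continuous family with round two-point function, crossing-symmetric `B₃`-invariant four-point
function inside the round Griffiths–Lebowitz corridor, and OS-positive in the nine lattice mirrors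
on the even sector spanned by `Ω` and two-field vectors, has a round four-point function. -/
theorem fourPoint_round_of_nineMirror_crossing_pincer
    (Δ : ℝ) (S : CorrFamily 3) (hΔ : 1 / 2 ≤ Δ) (hΔ' : Δ ≤ 1)
    (hcont : ∀ n, ContinuousOn (S n) (NonCoincident 3 n))
    (hnorm : ∀ n z, z ∉ NonCoincident 3 n → S n z = 0)
    (htrans : IsTranslationInvariant S) (hscale : IsScaleCovariant Δ S)
    (hpos : IsNondegenerateTwoPoint S)
    -- round two-point function
    (hround : ∀ (R : E3 ≃ₗᵢ[ℝ] E3) (x y : E3), S 2 ![R x, R y] = S 2 ![x, y])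
    -- crossing symmetry of `S₄` and symmetry of `S₂`
    (hcross : ∀ (σ : Equiv.Perm (Fin 4)) (x : Fin 4 → E3), S 4 (x ∘ σ) = S 4 x)
    (hsymm2 : ∀ x y : E3, S 2 ![x, y] = S 2 ![y, x])
    -- hyperoctahedral invariance of `S₄`
    (hB3 : ∀ R : E3 ≃ₗᵢ[ℝ] E3, IsSignedPermIsometry R →
      ∀ x : Fin 4 → E3, S 4 (fun i => R (x i)) = S 4 x)
    -- the round Griffiths II / Lebowitz corridor
    (hGKS : ∀ x ∈ NonCoincident 3 4, S 2 ![x 0, x 1] * S 2 ![x 2, x 3] ≤ S 4 x)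
    (hLeb : ∀ x ∈ NonCoincident 3 4, limitConnectedFour S x ≤ 0)
    -- OS positivity in the nine lattice mirrors on the even sector `{Ω, σσΩ}`
    (hOS : ∀ n : E3, IsLatticeMirrorNormal n →
      ∀ (m : ℕ) (c₀ : ℝ) (c : Fin m → ℝ) (p q : Fin m → E3),
        (∀ a, 0 < inner ℝ (p a) n ∧ 0 < inner ℝ (q a) n) →
        0 ≤ c₀ ^ 2 + 2 * c₀ * ∑ a, c a * S 2 ![p a, q a] +
          ∑ a, ∑ b, c a * c b *
            S 4 ![((ℝ ∙ n)ᗮ).reflection (p a), ((ℝ ∙ n)ᗮ).reflection (q a), p b, q b]) :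
    ∀ (R : E3 ≃ₗᵢ[ℝ] E3) (x : Fin 4 → E3), S 4 (fun i => R (x i)) = S 4 x := by
  sorry

/-- The transfer target C⁺ proper (all `n`): nine-mirror OS positivity on ALL sectors (configurations of
any sizes concatenated with `Fin.append`), crossing symmetry for all `n`, `B₃`, translation and scale
covariance, continuity, normalisation, and a ROUND two-point function force full `O(3)` invariance.
Model-blind; strictly stronger than the crux (whose Ising hypothesis supplies every premise via
FILS reflection positivity, lattice symmetry and the cell-straddling continuity argument). -/
theorem rotation_of_nineMirrorOS_crossing_roundTwoPoint
    (Δ : ℝ) (S : CorrFamily 3) (hΔ : 1 / 2 ≤ Δ) (hΔ' : Δ ≤ 1)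
    (hcont : ∀ n, ContinuousOn (S n) (NonCoincident 3 n))
    (hnorm : ∀ n z, z ∉ NonCoincident 3 n → S n z = 0)
    (h0 : ∀ z, S 0 z = 1)
    (htrans : IsTranslationInvariant S) (hscale : IsScaleCovariant Δ S)
    (hpos : IsNondegenerateTwoPoint S)
    (hround : ∀ (R : E3 ≃ₗᵢ[ℝ] E3) (x y : E3), S 2 ![R x, R y] = S 2 ![x, y])
    (hcross : ∀ n (σ : Equiv.Perm (Fin n)) (x : Fin n → E3), S n (x ∘ σ) = S n x)
    (hB3 : ∀ R : E3 ≃ₗᵢ[ℝ] E3, IsSignedPermIsometry R →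
      ∀ n (x : Fin n → E3), S n (fun i => R (x i)) = S n x)
    (hOS : ∀ n : E3, IsLatticeMirrorNormal n →
      ∀ (N : ℕ) (k : Fin N → ℕ) (c : Fin N → ℝ) (A : (a : Fin N) → Fin (k a) → E3),
        (∀ a i, 0 < inner ℝ (A a i) n) →
        0 ≤ ∑ a, ∑ b, c a * c b *
          S (k a + k b) (Fin.append (fun i => ((ℝ ∙ n)ᗮ).reflection (A a i)) (A b))) :
    IsRotationInvariant S := by
  sorry

/-! ## The `n = 2` shadow already has teeth: branch-point (unitarity) lemma

A homogeneous kernel `‖x‖^{-2s} P(x/‖x‖)` with `P` a polynomial and `0 < s < 1`, even under and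
reflection positive with respect to ONE coordinate mirror, has `P` constant on the sphere.
(Laplace representation in mirror time ⇒ `p₃² ↦ K̂` is a Pick/Stieltjes function; Funk–Hecke ⇒
the top harmonic of `P` produces a singularity `(p₃² + q²)^{-α}` with `α > 1` at the branch
point, whose imaginary part changes sign.) -/
theorem branchPoint_unitarity
    (s : ℝ) (hs : 0 < s) (hs' : s < 1) (P : MvPolynomial (Fin 3) ℝ)
    (K : E3 → ℝ) (hK : ∀ x : E3, x ≠ 0 →
      K x = ‖x‖ ^ (-(2 * s)) * MvPolynomial.eval (fun i => (‖x‖⁻¹ • x) i) P)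
    (heven : ∀ x : E3, K (((ℝ ∙ (EuclideanSpace.single (2 : Fin 3) (1 : ℝ)))ᗮ).reflection x) = K x)
    (hRP : ∀ (m : ℕ) (p : Fin m → E3) (c : Fin m → ℝ),
      (∀ a, 0 < inner ℝ (p a) (EuclideanSpace.single (2 : Fin 3) (1 : ℝ))) →
      0 ≤ ∑ a, ∑ b, c a * c b *
        K (p a - ((ℝ ∙ (EuclideanSpace.single (2 : Fin 3) (1 : ℝ)))ᗮ).reflection (p b))) :
    ∀ x y : E3, x ≠ 0 → y ≠ 0 → ‖x‖ = ‖y‖ → K x = K y := by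
  sorry

end Summit.CriticalPhenomena.Ising3DConformalLimit.Cruxes.RotationUpgradeFromTwoPoint.Ideator3
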